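import Literature.InformationTheory.QuantumCodes.BivariateBicycleCodes
import HarnessLib

/-!
# The sixth code of Bravyi et al.'s Table 3: `[[360, 12, ≤ 24]]` = `QC(x⁹+y+y², y³+x²⁵+x²⁶)` on `ℤ₃₀ × ℤ₆`

Bravyi–Cross–Gambetta–Maslov–Rall–Yoder, Nature 627 (2024) [BravyiEtAl2024], Extended Data Table 1
(= arXiv:2308.07915v2 Table 3) lists, besides the five codes typed in `BivariateBicycleCodes.lean`
(`bb72`, `bb90`, `bb108`, `bb144`, `bb288`, whose distances are printed as exact), two codes whose
distance is printed as an UPPER BOUND only ("The notation `≤d` indicates that only an upper bound on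
the code distance is known at the time of this writing", Nature ED Table 1 caption p0011 L6–7):
`[[360,12,≤24]]` (`ℓ = 30, m = 6`, `A = x⁹+y+y²`, `B = y³+x²⁵+x²⁶`) and `[[756,16,≤34]]`.  The main text
singles the first out: "The code `[[360,12,≤24]]` improves upon a code `[[882,24,≤24]]` with weight-6
checks found by Panteleev and Kalachev (assuming that our distance upper bound is tight)"
(arXiv:2308.07915 chunk p0009 L48–50).

This file types the `[[360,12,≤24]]` code as DATA (`bb360`), with its qubit count and the printed
weight-(3,3) side condition, so that the structural statements of [BravyiEtAl2024, §5] about "all codes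
in Table" (connected Tanner graph, toric layout) can be instantiated on it Summits-side.  Its printed
parameters are a CLAIM (upper bound `d ≤ 24`; `k = 12`), NOT asserted here.

Locators. `(ℓ, m) = (30, 6)`: Nature SI Table 6 "Base Order" row (paper:url-bcdd6c4b24ed p0018 L1–6,
as cross-read by qec-lit-3, HOME/lit/BB-TABLE3-arxiv-2308.07915v2.md).  `A, B`: the table body is an
image in the held primary copies; read on the lit-materialised SECONDARY page Symons–Rajput–Browne,
arXiv:2511.13560, Table 1 p. 35 L15: "`[[360,12,24]] 30 6 5 x⁹+y+y² y³+x²⁵+x²⁶`" ("Codes from the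
original BB codes paper [34] are highlighted in bold", p. 35 L20–21), agreeing with the arXiv-HTML
extraction of Table 3 recorded in HOME/lit/BB-TABLE3-arxiv-2308.07915v2.md (grade provisional-primary +
secondary-lit).  The seventh code `[[756,16,≤34]]` (`ℓ = 21, m = 18`, `A = x³+y¹⁰+y¹⁷`, `B = y⁵+x³+x¹⁹`
per the same extraction) has no lit-materialised page yet and is deliberately NOT typed.
-/

namespace Literature.InformationTheory.QuantumCodes

namespace BB

/-- The `[[360,12,≤24]]` code of [BravyiEtAl2024, Table 3]: `ℓ = 30, m = 6`, `A = x⁹ + y + y²`,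
`B = y³ + x²⁵ + x²⁶`. DATA; its printed parameters (`k = 12`, distance `≤ 24`, an upper bound only) are
a CLAIM, not asserted here. `(ℓ,m)`: Nature SI Table 6 (p0018); `A, B`: secondary page
arXiv:2511.13560 Table 1 p0035 L15 "`[[360,12,24]] 30 6 5 x^9+y+y^2 y^3+x^25+x^26`".
[cite: BravyiEtAl2024, Extended Data Table 1 / arXiv Table 3 row [[360,12,≤24]]; §4 (arXiv:2308.07915 chunk p0009 L48–50); SI Table 6 (p. 18)] -/
def bb360 : Code 30 6 := ⟨xPow 9 + yPow 1 + yPow 2, yPow 3 + xPow 25 + xPow 26⟩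

/-- `n = 2ℓm = 360` for `(ℓ, m) = (30, 6)`. Proved (counting).
[cite: BravyiEtAl2024, Extended Data Table 1 / arXiv Table 3 row [[360,12,≤24]]] -/
theorem numQubits_bb360 : numQubits 30 6 = 360 := by
  simp only [numQubits_eq]

/-- `bb360` satisfies the printed side condition (three distinct powers of `x` or `y` in `A` and in `B`).
[cite: BravyiEtAl2024, §4 (arXiv:2308.07915 chunk p0009 L20–24)] -/
theorem isBBPoly_bb360 : IsBBPoly bb360.A ∧ IsBBPoly bb360.B :=
  ⟨⟨(Fin.ofNat 30 9, 0), (0, Fin.ofNat 6 1), (0, Fin.ofNat 6 2), by decide, by decide, by decide,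
      ⟨Or.inr rfl, Or.inl rfl, Or.inl rfl⟩, rfl⟩,
    ⟨(0, Fin.ofNat 6 3), (Fin.ofNat 30 25, 0), (Fin.ofNat 30 26, 0), by decide, by decide, by decide,
      ⟨Or.inl rfl, Or.inr rfl, Or.inr rfl⟩, rfl⟩⟩

end BB

end Literature.InformationTheory.QuantumCodes
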